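import Literature.NumberTheory.LFunctions.MauduitRivatFourierL2Split
import Literature.NumberTheory.LFunctions.MauduitRivatKernelSums
import HarnessLib

/-!
# The discrete Fourier transform of the middle-digit function: the `G₁`-part and Lemmas 10–11 of Mauduit–Rivat 2015 for unitary matrices (Müllner 2017, Lemma 5.6; proved)

Everything in this file is PROVED (plus plain definitions). It completes, for unitary-matrix
weights `F = U ∘ f`, the formalisation of §7 of C. Mauduit, J. Rivat, J. Eur. Math. Soc. 17
(2015) begun in `MauduitRivatFourierL2Split.lean` (`U(g) = gmatMain + (gmat − gmatMain)`, the
error part being small in mean square by the carry property). For the main part we group the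
digits `v = w + v'k^{ρ₃}` by the residue `w` that the truncated quotient depends on (this replaces
the character sum over `ℓ < q^{ρ₃}` of the printed proof and leads to the same bound):

* `norm_sum_AP_smul_le` — **the completion step** (MR p. 2626): a sum of `e(−uθ)X(u)` over an
  arithmetic progression `{b + a₁D}` inside `[0, N)`, `N = QD`, is at most
  `(B/N) · D · (2L + Q(1 + log Q))` if all complete twisted sums `∑_{u<N} e(−ut')X(u)` are `≤ B`
  (orthogonality of additive characters mod `N`, geometric sums, MR Lemma 4);
* `cfun`, `norm_cfun_le` — the left factor `c(w,t) = k^{−λ} ∑_{a<k^λ} e(−at/k^Λ) L(a,w)` and its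
  uniform bound `‖c(w,t)‖ ≤ 3 k^{Δ+ρ₃} k^{−γ(λ+ρ₃)} (1 + log k^{λ+ρ₃−Δ})`, `Δ = μ₁ − μ₀`, from the
  Fourier property of `F` at the scale `(α, λ) = (μ₀, λ+ρ₃)` (MR: "`|c_λ(w,t)| ≪ q^{ρ₃+μ₁−μ₀−γ(λ+ρ₃)} log …`");
* `dftR_gmatMain_eq` — the factorisation `dftR k^Λ gmatMain t = ∑_{w<k^{ρ₃}} c(w,t) · W(w,t)` with
  `W(w,t) = k^{−λ'} ∑_{v'} e(−(w+v'k^{ρ₃})t/k^{λ'}) F((w+v'k^{ρ₃})k^α)`, and `sum_norm_sq_Wfun`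
  (`∑_{j<k^{λ'}} ‖W(w, j+t)‖² = d/k^{ρ₃}` by periodicity and Parseval);
* `sum_norm_sq_dftR_gmatMain_le` — **the `G₁`-part**: `∑_{j<k^{λ'}} ‖dftR gmatMain (j+t)‖² ≤ d k^{ρ₃} Cb²`;
* `sum_norm_sq_dftR_gmat_le` — **MR Lemma 11 / Müllner Lemma 5.6 (matrix form, raw parameters)**:
  `∑_{j<k^{λ'}} ‖ĝ(j + t)‖² ≤ 2 d k^{ρ₃} Cb² + 8 d C k^{−ηρ₃}`, uniformly in `t`;
* `sum_sum_norm_sq_ghat_mul_le` — **MR Lemma 10 (matrix form)**: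
  `∑_{h<k^Λ} ∑_{j<k^{λ'}} ‖ĝ(h+j) ĝ(h)ᴴ‖² ≤ d · (2 d k^{ρ₃} Cb² + 8 d C k^{−ηρ₃})` (Parseval `∑_h ‖ĝ(h)‖² = d`).

## References
* C. Mauduit, J. Rivat, J. Eur. Math. Soc. 17 (2015), §7: Lemma 10 ((77)–(79)), Lemma 11
  ((94)–(96)) and its proof (pp. 2623–2628); Lemma 4. [MauduitRivat2015]
* C. Müllner, Duke Math. J. 166 (2017) = arXiv:1602.03042, Lemma 5.6 (p. 28). [Mullner2017]
-/

noncomputable section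

open Finset Complex Matrix
open scoped FourierTransform InnerProductSpace ComplexConjugate Matrix.Norms.Frobenius

namespace Literature.NumberTheory.LFunctions.MauduitRivat

open Literature.NumberTheory.Sieve.RamanujanSum (sum_range_fourierChar_div)
open Literature.NumberTheory.Sieve.Vinogradov (geomBound geomBound_nonneg distInt distInt_add_int
  norm_sum_Icc_fourierChar_le_geomBound)

/-! ## The completion step (generic normed space) -/

section Completion

variable {E : Type*} [NormedAddCommGroup E] [NormedSpace ℂ E]

/-- `‖∑_{a<L} e(a x)‖ ≤ min(V, 1/(2‖x‖))` for `L ≤ V` (Nathanson Lemma 4.7 for `{0,…,L−1}`).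
[cite: MauduitRivat2015, (20)] -/
theorem norm_sum_range_fourierChar_le_geomBound {L : ℕ} {V : ℝ} (x : ℝ) (hL : (L : ℝ) ≤ V) :
    ‖∑ a ∈ range L, (𝐞 ((a : ℝ) * x) : ℂ)‖ ≤ geomBound V x := by
  have h := norm_sum_Icc_fourierChar_le_geomBound x hL
  have e : ∑ n ∈ Icc 1 L, (𝐞 ((n : ℝ) * x) : ℂ) = (𝐞 x : ℂ) * ∑ a ∈ range L, (𝐞 ((a : ℝ) * x) : ℂ) := by
    rw [show Icc 1 L = Ico 1 (L + 1) by ext n; simp only [mem_Icc, mem_Ico]; omega,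
      sum_Ico_eq_sum_range, show L + 1 - 1 = L from rfl, mul_sum]
    refine sum_congr rfl fun a _ => ?_
    rw [coe_fourierChar_mul]; congr 1; push_cast; ring
  rwa [e, norm_mul, norm_fourierChar, one_mul] at h

/-- `geomBound V (x + 1) = geomBound V x`. [folklore] -/
theorem geomBound_add_one (V x : ℝ) : geomBound V (x + 1) = geomBound V x := by
  unfold geomBound; rw [show x + 1 = x + ((1 : ℤ) : ℝ) by push_cast; ring, distInt_add_int]

/-- **Sums over an arithmetic progression from complete twisted sums** (the completion step of
MR p. 2626: "The sum over `u₁` may be written as a sum over `u''` … In order to use (7) …").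
Let `N = Q·D` with `Q, D ≥ 1`, `X : ℕ → E`, `θ ∈ ℝ`, and suppose every complete twisted sum is
bounded: `‖∑_{u<N} e(−ut') X(u)‖ ≤ B` for all real `t'`. Then for an arithmetic progression
`b + a₁D` (`a₁ < L`) contained in `[0, N)`,
`‖∑_{a₁<L} e(−(b+a₁D)θ) X(b+a₁D)‖ ≤ (B/N) · D · (2L + Q(1 + log Q))`.
[cite: MauduitRivat2015, Lemma 11 (proof, p. 2626) with Lemma 4] -/
theorem norm_sum_AP_smul_le {N Q D L b : ℕ} (hN : N = Q * D) (hQ : 0 < Q) (hD : 0 < D)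
    (hfit : ∀ a₁, a₁ < L → b + a₁ * D < N) (X : ℕ → E) (θ : ℝ) {B : ℝ}
    (hB : ∀ t' : ℝ, ‖∑ u ∈ range N, (𝐞 (-((u : ℝ) * t')) : ℂ) • X u‖ ≤ B) :
    ‖∑ a₁ ∈ range L, (𝐞 (-(((b + a₁ * D : ℕ) : ℝ) * θ)) : ℂ) • X (b + a₁ * D)‖ ≤
      B / N * D * (2 * L + Q * (1 + Real.log Q)) := by
  have hN0 : 0 < N := by rw [hN]; positivity
  have hNR : (0 : ℝ) < N := by exact_mod_cast hN0
  have hNC : (N : ℂ) ≠ 0 := by exact_mod_cast hN0.ne'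
  have hB0 : 0 ≤ B := le_trans (norm_nonneg _) (hB 0)
  -- the complete sums at shifted frequencies
  set S : ℝ → E := fun t' => ∑ u ∈ range N, (𝐞 (-((u : ℝ) * t')) : ℂ) • X u with hS
  -- the character sums selecting the progression
  set χ : ℕ → ℂ := fun ℓ => ∑ a₁ ∈ range L, (𝐞 ((ℓ : ℝ) * ((b + a₁ * D : ℕ) : ℝ) / N) : ℂ) with hχ
  -- Step 1: the identity `LHS = N⁻¹ ∑_ℓ χ(ℓ) • S(θ + ℓ/N)`
  have hident : ∑ a₁ ∈ range L, (𝐞 (-(((b + a₁ * D : ℕ) : ℝ) * θ)) : ℂ) • X (b + a₁ * D) =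
      ((N : ℂ)⁻¹) • ∑ ℓ ∈ range N, χ ℓ • S (θ + ℓ / N) := by
    -- expand the right-hand side
    have hexp : ∑ ℓ ∈ range N, χ ℓ • S (θ + ℓ / N) =
        ∑ a₁ ∈ range L, ∑ u ∈ range N,
          (∑ ℓ ∈ range N, (𝐞 ((ℓ : ℝ) * (((b + a₁ * D : ℕ) : ℤ) - (u : ℤ) : ℤ) / N) : ℂ)) •
            ((𝐞 (-((u : ℝ) * θ)) : ℂ) • X u) := by
      calc ∑ ℓ ∈ range N, χ ℓ • S (θ + ℓ / N)
          = ∑ ℓ ∈ range N, ∑ a₁ ∈ range L, ∑ u ∈ range N,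
              ((𝐞 ((ℓ : ℝ) * ((b + a₁ * D : ℕ) : ℝ) / N) : ℂ) * (𝐞 (-((u : ℝ) * (θ + ℓ / N))) : ℂ)) • X u := by
            refine sum_congr rfl fun ℓ _ => ?_
            rw [hχ, hS, sum_smul]
            refine sum_congr rfl fun a₁ _ => ?_
            rw [smul_sum]
            refine sum_congr rfl fun u _ => ?_
            rw [smul_smul]
        _ = ∑ a₁ ∈ range L, ∑ u ∈ range N, ∑ ℓ ∈ range N,
              ((𝐞 ((ℓ : ℝ) * ((b + a₁ * D : ℕ) : ℝ) / N) : ℂ) * (𝐞 (-((u : ℝ) * (θ + ℓ / N))) : ℂ)) • X u := by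
            rw [sum_comm]
            exact sum_congr rfl fun a₁ _ => sum_comm
        _ = _ := by
            refine sum_congr rfl fun a₁ _ => sum_congr rfl fun u _ => ?_
            rw [← sum_smul, smul_smul, sum_mul]
            congr 1
            refine sum_congr rfl fun ℓ _ => ?_
            rw [coe_fourierChar_mul, coe_fourierChar_mul]
            congr 1
            push_cast
            field_simp
            ring
    rw [hexp]
    -- orthogonality
    have horth : ∀ a₁ ∈ range L, ∀ u ∈ range N,
        (∑ ℓ ∈ range N, (𝐞 ((ℓ : ℝ) * (((b + a₁ * D : ℕ) : ℤ) - (u : ℤ) : ℤ) / N) : ℂ)) =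
          if u = b + a₁ * D then (N : ℂ) else 0 := by
      intro a₁ ha₁ u hu
      rw [sum_range_fourierChar_div hN0.ne']
      have hlt := hfit a₁ (mem_range.1 ha₁)
      have hu' := mem_range.1 hu
      have hiff : (N : ℤ) ∣ (((b + a₁ * D : ℕ) : ℤ) - (u : ℤ)) ↔ u = b + a₁ * D := by
        constructor
        · intro hdvd
          rcases hdvd with ⟨c, hc⟩
          have hc0 : c = 0 := by
            by_contra hne
            have h1 : |(((b + a₁ * D : ℕ) : ℤ) - (u : ℤ))| < N := by
              rw [abs_lt]; constructor <;> push_cast <;> omega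
            rw [hc, abs_mul, Nat.abs_cast] at h1
            have h2 : 1 ≤ |c| := Int.one_le_abs hne
            nlinarith
          rw [hc0, mul_zero, sub_eq_zero] at hc
          exact_mod_cast hc.symm
        · rintro rfl; simp
      by_cases h : u = b + a₁ * D
      · rw [if_pos (hiff.2 h), if_pos h]
      · rw [if_neg (fun h' => h (hiff.1 h')), if_neg h]
    rw [sum_congr rfl fun a₁ ha₁ => sum_congr rfl fun u hu => by rw [horth a₁ ha₁ u hu]]
    simp only [ite_smul, zero_smul, sum_ite_eq', mem_range]
    rw [smul_sum]
    refine sum_congr rfl fun a₁ ha₁ => ?_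
    rw [if_pos (hfit a₁ (mem_range.1 ha₁)), smul_smul, inv_mul_cancel₀ hNC, one_smul]
  -- Step 2: the bound on the character sums `‖χ ℓ‖ ≤ min(L, 1/(2‖ℓ/Q‖))`
  have hχle : ∀ ℓ : ℕ, ‖χ ℓ‖ ≤ geomBound L ((ℓ : ℝ) / Q) := by
    intro ℓ
    have e : χ ℓ = (𝐞 ((ℓ : ℝ) * b / N) : ℂ) * ∑ a₁ ∈ range L, (𝐞 ((a₁ : ℝ) * ((ℓ : ℝ) / Q)) : ℂ) := by
      rw [hχ, mul_sum]
      refine sum_congr rfl fun a₁ _ => ?_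
      rw [coe_fourierChar_mul]
      congr 1
      rw [hN]; push_cast
      field_simp
    rw [e, norm_mul, norm_fourierChar, one_mul]
    exact norm_sum_range_fourierChar_le_geomBound _ le_rfl
  -- Step 3: the kernel sum `∑_{ℓ<N} min(L, 1/(2‖ℓ/Q‖)) ≤ D (2L + Q(1 + log Q))`
  have hkernel : ∑ ℓ ∈ range N, geomBound L ((ℓ : ℝ) / Q) ≤ D * (2 * L + Q * (1 + Real.log Q)) := by
    have hper : ∀ n : ℕ, geomBound (L : ℝ) (((n + Q : ℕ) : ℝ) / Q) = geomBound L ((n : ℝ) / Q) := by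
      intro n
      have hQR : (Q : ℝ) ≠ 0 := by exact_mod_cast hQ.ne'
      rw [show (((n + Q : ℕ) : ℝ) / Q) = (n : ℝ) / Q + 1 by push_cast; field_simp, geomBound_add_one]
    rw [hN, sum_range_mul_of_periodic hper]
    gcongr
    have h4 := sum_range_geomBound_progression_le hQ 1 0 (V := (L : ℝ)) (Nat.cast_nonneg _)
    simp only [Nat.cast_one, one_mul, add_zero, Nat.gcd_one_left, mul_one] at h4
    exact h4
  -- Step 4: assemble
  rw [hident, norm_smul, norm_inv, Complex.norm_natCast]
  calc (N : ℝ)⁻¹ * ‖∑ ℓ ∈ range N, χ ℓ • S (θ + ℓ / N)‖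
      ≤ (N : ℝ)⁻¹ * ∑ ℓ ∈ range N, ‖χ ℓ‖ * B := by
        gcongr
        refine (norm_sum_le _ _).trans (sum_le_sum fun ℓ _ => ?_)
        rw [norm_smul]
        gcongr
        exact hB _
    _ ≤ (N : ℝ)⁻¹ * ∑ ℓ ∈ range N, geomBound L ((ℓ : ℝ) / Q) * B := by
        gcongr with ℓ _
        exact hχle ℓ
    _ = B / N * ∑ ℓ ∈ range N, geomBound L ((ℓ : ℝ) / Q) := by rw [← sum_mul]; ring
    _ ≤ B / N * (D * (2 * L + Q * (1 + Real.log Q))) := by gcongr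
    _ = _ := by ring

end Completion

/-! ## The left factor `c(w, t)` and its uniform bound -/

variable {d : Type*} [Fintype d] [DecidableEq d] {G : Type*} [Group G]

/-- The left factor of the main part after grouping by `w = v mod k^{ρ₃}`:
`c(w,t) = k^{−λ} ∑_{a<k^λ} e(−at/k^Λ) L(a,w)`, `Λ = λ + λ'`.
[cite: MauduitRivat2015, Lemma 11 (proof, the function c_λ(w,t))] -/
def cfun (U : G →* unitaryGroup d ℂ) (f : ℕ → G) (k μ₀ μ₁ lam lam' : ℕ) (w : ℕ) (t : ℝ) : Matrix d d ℂ :=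
  (((k ^ lam : ℕ) : ℂ)⁻¹) • ∑ a ∈ range (k ^ lam),
    (𝐞 (-((a : ℝ) * t / (k ^ (lam + lam') : ℕ))) : ℂ) • Lmat U f k μ₀ μ₁ (μ₀ + lam) a w

/-- **The uniform bound on `c(w, t)`** (MR p. 2626: "`|c_λ(w,t)| ≪ q^{ρ₃+μ₁−μ₀−γ(λ+ρ₃)} log q^{λ+ρ₃−μ₁+μ₀}`"):
if `F = U ∘ f` has the Fourier property with `(γ, c)` and `μ₀ ≤ c(λ+ρ₃)`, then for `μ₀ ≤ μ₁`,
`Δ = μ₁ − μ₀ ≤ λ`, `w < k^{ρ₃}`, all real `t`: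
`‖c(w,t)‖ ≤ 3 k^{Δ+ρ₃} k^{−γ(λ+ρ₃)} (1 + log k^{λ+ρ₃−Δ})`. Proof: pull out the right unitary factor,
split `a = a₀ + a₁k^Δ` (`F_{μ₁}(ak^{μ₀}) = F_{μ₁}(a₀k^{μ₀})`), and bound each `a₁`-sum — a twisted sum
of `F(u''k^{μ₀})` over the progression `u'' = a₀ + wk^λ + a₁k^Δ` inside `[0, k^{λ+ρ₃})` — by
`norm_sum_AP_smul_le` with the complete sums controlled by the Fourier property at scale
`(α, λ) = (μ₀, λ+ρ₃)`. [cite: MauduitRivat2015, Lemma 11 (proof, pp. 2625–2626)] -/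
theorem norm_cfun_le (U : G →* unitaryGroup d ℂ) (f : ℕ → G) {k : ℕ} (hk : 2 ≤ k) {γ : ℝ → ℝ} {c : ℝ}
    (hF : HasFourierProperty k γ c (umat U f)) {μ₀ μ₁ lam lam' ρ₃ : ℕ} (h01 : μ₀ ≤ μ₁)
    (hlam : μ₁ - μ₀ ≤ lam) (hc : (μ₀ : ℝ) ≤ c * ((lam + ρ₃ : ℕ) : ℝ)) {w : ℕ} (hw : w < k ^ ρ₃) (t : ℝ) :
    ‖cfun U f k μ₀ μ₁ lam lam' w t‖ ≤
      3 * (k : ℝ) ^ (μ₁ - μ₀ + ρ₃) * (k : ℝ) ^ (-γ ((lam + ρ₃ : ℕ) : ℝ)) *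
        (1 + Real.log ((k : ℝ) ^ (lam + ρ₃ - (μ₁ - μ₀)))) := by
  have hk0 : 0 < k := by omega
  have hkR : (0 : ℝ) < k := by exact_mod_cast hk0
  have hK₁eq : k ^ lam = k ^ ((μ₁ - μ₀) + (lam - (μ₁ - μ₀))) := by congr 1; omega
  have hK₁DL : k ^ lam = k ^ (μ₁ - μ₀) * k ^ (lam - (μ₁ - μ₀)) := by rw [hK₁eq, pow_add]
  have hNQD : k ^ (lam + ρ₃) = k ^ (lam + ρ₃ - (μ₁ - μ₀)) * k ^ (μ₁ - μ₀) := by rw [← pow_add]; congr 1; omega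
  have hK₁pos : 0 < k ^ lam := by positivity
  have hK₁R : (0 : ℝ) < (k ^ lam : ℕ) := by exact_mod_cast hK₁pos
  -- Step 1: remove the right unitary factor `F(wk^α)ᴴ`
  have e0 : ∑ a ∈ range (k ^ lam), (𝐞 (-((a : ℝ) * t / ((k ^ (lam + lam') : ℕ) : ℝ))) : ℂ) •
      Lmat U f k μ₀ μ₁ (μ₀ + lam) a w =
      (∑ a ∈ range (k ^ lam), (𝐞 (-((a : ℝ) * t / ((k ^ (lam + lam') : ℕ) : ℝ))) : ℂ) •
        ((umat U (trunc k μ₁ f) (a * k ^ μ₀))ᴴ * umat U f (a * k ^ μ₀ + w * k ^ (μ₀ + lam)))) *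
        ((U (f (w * k ^ (μ₀ + lam))))⁻¹ : unitaryGroup d ℂ) := by
    rw [sum_mul, coe_inv_unitary]
    refine sum_congr rfl fun a _ => ?_
    rw [Lmat, smul_mul_assoc, Matrix.mul_assoc]
  have hstep1 : ‖cfun U f k μ₀ μ₁ lam lam' w t‖ =
      ((k ^ lam : ℕ) : ℝ)⁻¹ * ‖∑ a ∈ range (k ^ lam), (𝐞 (-((a : ℝ) * t / ((k ^ (lam + lam') : ℕ) : ℝ))) : ℂ) •
        ((umat U (trunc k μ₁ f) (a * k ^ μ₀))ᴴ * umat U f (a * k ^ μ₀ + w * k ^ (μ₀ + lam)))‖ := by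
    rw [cfun, e0, norm_smul, norm_inv, Complex.norm_natCast, norm_mul_unitary]
  -- Step 2: the digit split `a = a₀ + a₁ k^Δ`, the common left unitary factor and a constant phase
  have hstep2 : ‖∑ a ∈ range (k ^ lam), (𝐞 (-((a : ℝ) * t / ((k ^ (lam + lam') : ℕ) : ℝ))) : ℂ) •
        ((umat U (trunc k μ₁ f) (a * k ^ μ₀))ᴴ * umat U f (a * k ^ μ₀ + w * k ^ (μ₀ + lam)))‖ ≤
      ∑ a₀ ∈ range (k ^ (μ₁ - μ₀)), ‖∑ a₁ ∈ range (k ^ (lam - (μ₁ - μ₀))),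
        (𝐞 (-((((a₀ + w * k ^ lam) + a₁ * k ^ (μ₁ - μ₀) : ℕ) : ℝ) * (t / ((k ^ (lam + lam') : ℕ) : ℝ)))) : ℂ) •
          umat U f ((a₀ + w * k ^ lam + a₁ * k ^ (μ₁ - μ₀)) * k ^ μ₀)‖ := by
    rw [show range (k ^ lam) = range (k ^ ((μ₁ - μ₀) + (lam - (μ₁ - μ₀)))) by rw [hK₁eq],
      sum_range_pow_add_digitSplit _ k (μ₁ - μ₀) (lam - (μ₁ - μ₀)), sum_comm]
    refine (norm_sum_le _ _).trans (sum_le_sum fun a₀ _ => le_of_eq ?_)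
    -- in the `a₁`-sum the left factor is constant
    have hconst : ∀ a₁ : ℕ, umat U (trunc k μ₁ f) ((a₀ + a₁ * k ^ (μ₁ - μ₀)) * k ^ μ₀) =
        umat U (trunc k μ₁ f) (a₀ * k ^ μ₀) := by
      intro a₁
      have : (a₀ + a₁ * k ^ (μ₁ - μ₀)) * k ^ μ₀ = a₀ * k ^ μ₀ + a₁ * k ^ μ₁ := by
        rw [add_mul, mul_assoc, ← pow_add, Nat.sub_add_cancel h01]
      rw [umat, umat, this, trunc_add_mul_pow]
    have hargs : ∀ a₁ : ℕ, (a₀ + a₁ * k ^ (μ₁ - μ₀)) * k ^ μ₀ + w * k ^ (μ₀ + lam) =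
        (a₀ + w * k ^ lam + a₁ * k ^ (μ₁ - μ₀)) * k ^ μ₀ := by
      intro a₁; rw [pow_add]; ring
    have e : ∑ a₁ ∈ range (k ^ (lam - (μ₁ - μ₀))),
        (𝐞 (-(((a₀ + a₁ * k ^ (μ₁ - μ₀) : ℕ) : ℝ) * t / ((k ^ (lam + lam') : ℕ) : ℝ))) : ℂ) •
          ((umat U (trunc k μ₁ f) ((a₀ + a₁ * k ^ (μ₁ - μ₀)) * k ^ μ₀))ᴴ *
            umat U f ((a₀ + a₁ * k ^ (μ₁ - μ₀)) * k ^ μ₀ + w * k ^ (μ₀ + lam))) =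
        (umat U (trunc k μ₁ f) (a₀ * k ^ μ₀))ᴴ *
          ((𝐞 (((w * k ^ lam : ℕ) : ℝ) * t / ((k ^ (lam + lam') : ℕ) : ℝ)) : ℂ) •
            ∑ a₁ ∈ range (k ^ (lam - (μ₁ - μ₀))),
              (𝐞 (-((((a₀ + w * k ^ lam) + a₁ * k ^ (μ₁ - μ₀) : ℕ) : ℝ) * (t / ((k ^ (lam + lam') : ℕ) : ℝ)))) : ℂ) •
                umat U f ((a₀ + w * k ^ lam + a₁ * k ^ (μ₁ - μ₀)) * k ^ μ₀)) := by
      rw [smul_sum, Matrix.mul_sum]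
      refine sum_congr rfl fun a₁ _ => ?_
      rw [hconst, hargs, smul_smul, coe_fourierChar_mul, Matrix.mul_smul]
      congr 2
      push_cast; ring
    rw [e]
    show ‖((U (trunc k μ₁ f (a₀ * k ^ μ₀)) : unitaryGroup d ℂ) : Matrix d d ℂ)ᴴ * _‖ = _
    rw [← coe_inv_unitary, norm_unitary_mul, norm_smul, norm_fourierChar, one_mul]
  -- Step 3: each `a₁`-sum is a twisted sum over a progression inside `[0, k^{λ+ρ₃})`
  have hB : ∀ t' : ℝ, ‖∑ u ∈ range (k ^ (lam + ρ₃)), (𝐞 (-((u : ℝ) * t')) : ℂ) • umat U f (u * k ^ μ₀)‖ ≤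
      (k : ℝ) ^ (lam + ρ₃) * (k : ℝ) ^ (-γ ((lam + ρ₃ : ℕ) : ℝ)) := by
    intro t'
    have h := hF μ₀ (lam + ρ₃) hc t'
    rw [norm_smul, norm_inv, Real.norm_of_nonneg (by positivity), inv_mul_le_iff₀ (by positivity)] at h
    exact h
  have hfit : ∀ a₀, a₀ < k ^ (μ₁ - μ₀) → ∀ a₁, a₁ < k ^ (lam - (μ₁ - μ₀)) →
      a₀ + w * k ^ lam + a₁ * k ^ (μ₁ - μ₀) < k ^ (lam + ρ₃) := by
    intro a₀ ha₀ a₁ ha₁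
    -- `a₀ + a₁D < D·L = k^λ` and `(w+1)k^λ ≤ k^{ρ₃} k^λ = k^{λ+ρ₃}`
    have h1 : a₀ + a₁ * k ^ (μ₁ - μ₀) < k ^ lam := by
      rw [hK₁DL]
      have : a₁ + 1 ≤ k ^ (lam - (μ₁ - μ₀)) := ha₁
      nlinarith
    have h2 : (w + 1) * k ^ lam ≤ k ^ (lam + ρ₃) := by
      rw [show k ^ (lam + ρ₃) = k ^ ρ₃ * k ^ lam by rw [← pow_add, add_comm]]
      exact Nat.mul_le_mul_right _ hw
    nlinarith
  have hsum := hstep2.trans (sum_le_sum fun a₀ ha₀ =>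
    norm_sum_AP_smul_le hNQD (by positivity) (by positivity) (hfit a₀ (mem_range.1 ha₀))
      (fun u => umat U f (u * k ^ μ₀)) (t / ((k ^ (lam + lam') : ℕ) : ℝ)) hB)
  rw [sum_const, card_range, nsmul_eq_mul] at hsum
  -- Step 4: assemble the arithmetic
  have hγ0 : 0 ≤ (k : ℝ) ^ (-γ ((lam + ρ₃ : ℕ) : ℝ)) := by positivity
  have hlogQ : 0 ≤ Real.log (((k ^ (lam + ρ₃ - (μ₁ - μ₀)) : ℕ) : ℝ)) :=
    Real.log_nonneg (by exact_mod_cast Nat.one_le_pow _ _ hk0)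
  have hR1 : (1 : ℝ) ≤ ((k ^ ρ₃ : ℕ) : ℝ) := by exact_mod_cast Nat.one_le_pow _ _ hk0
  have hDL : ((k ^ (μ₁ - μ₀) : ℕ) : ℝ) * ((k ^ (lam - (μ₁ - μ₀)) : ℕ) : ℝ) = ((k ^ lam : ℕ) : ℝ) := by
    rw [hK₁DL]; push_cast; ring
  have hDQ : ((k ^ (μ₁ - μ₀) : ℕ) : ℝ) * ((k ^ (lam + ρ₃ - (μ₁ - μ₀)) : ℕ) : ℝ) =
      ((k ^ lam : ℕ) : ℝ) * ((k ^ ρ₃ : ℕ) : ℝ) := by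
    have : k ^ (μ₁ - μ₀) * k ^ (lam + ρ₃ - (μ₁ - μ₀)) = k ^ lam * k ^ ρ₃ := by
      rw [← pow_add, ← pow_add]; congr 1; omega
    exact_mod_cast this
  have hBN : (k : ℝ) ^ (lam + ρ₃) * (k : ℝ) ^ (-γ ((lam + ρ₃ : ℕ) : ℝ)) / ((k ^ (lam + ρ₃) : ℕ) : ℝ) =
      (k : ℝ) ^ (-γ ((lam + ρ₃ : ℕ) : ℝ)) := by
    have hkne : (k : ℝ) ^ (lam + ρ₃) ≠ 0 := by positivity
    rw [Nat.cast_pow]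
    field_simp
  rw [hstep1]
  calc ((k ^ lam : ℕ) : ℝ)⁻¹ * ‖∑ a ∈ range (k ^ lam), (𝐞 (-((a : ℝ) * t / ((k ^ (lam + lam') : ℕ) : ℝ))) : ℂ) •
          ((umat U (trunc k μ₁ f) (a * k ^ μ₀))ᴴ * umat U f (a * k ^ μ₀ + w * k ^ (μ₀ + lam)))‖
      ≤ ((k ^ lam : ℕ) : ℝ)⁻¹ * (((k ^ (μ₁ - μ₀) : ℕ) : ℝ) *
          ((k : ℝ) ^ (lam + ρ₃) * (k : ℝ) ^ (-γ ((lam + ρ₃ : ℕ) : ℝ)) / ((k ^ (lam + ρ₃) : ℕ) : ℝ) *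
            ((k ^ (μ₁ - μ₀) : ℕ) : ℝ) * (2 * ((k ^ (lam - (μ₁ - μ₀)) : ℕ) : ℝ) +
              ((k ^ (lam + ρ₃ - (μ₁ - μ₀)) : ℕ) : ℝ) * (1 + Real.log (((k ^ (lam + ρ₃ - (μ₁ - μ₀)) : ℕ) : ℝ)))))) := by
        gcongr
    _ = (k : ℝ) ^ (-γ ((lam + ρ₃ : ℕ) : ℝ)) * ((k ^ (μ₁ - μ₀) : ℕ) : ℝ) *
          (((k ^ lam : ℕ) : ℝ)⁻¹ * (2 * (((k ^ (μ₁ - μ₀) : ℕ) : ℝ) * ((k ^ (lam - (μ₁ - μ₀)) : ℕ) : ℝ)) +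
            (((k ^ (μ₁ - μ₀) : ℕ) : ℝ) * ((k ^ (lam + ρ₃ - (μ₁ - μ₀)) : ℕ) : ℝ)) *
              (1 + Real.log (((k ^ (lam + ρ₃ - (μ₁ - μ₀)) : ℕ) : ℝ))))) := by
        rw [hBN]; ring
    _ = (k : ℝ) ^ (-γ ((lam + ρ₃ : ℕ) : ℝ)) * ((k ^ (μ₁ - μ₀) : ℕ) : ℝ) *
          (2 + ((k ^ ρ₃ : ℕ) : ℝ) * (1 + Real.log (((k ^ (lam + ρ₃ - (μ₁ - μ₀)) : ℕ) : ℝ)))) := by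
        rw [hDL, hDQ]
        field_simp
    _ ≤ (k : ℝ) ^ (-γ ((lam + ρ₃ : ℕ) : ℝ)) * ((k ^ (μ₁ - μ₀) : ℕ) : ℝ) *
          (3 * ((k ^ ρ₃ : ℕ) : ℝ) * (1 + Real.log (((k ^ (lam + ρ₃ - (μ₁ - μ₀)) : ℕ) : ℝ)))) := by
        gcongr
        nlinarith
    _ = 3 * (k : ℝ) ^ (μ₁ - μ₀ + ρ₃) * (k : ℝ) ^ (-γ ((lam + ρ₃ : ℕ) : ℝ)) *
          (1 + Real.log ((k : ℝ) ^ (lam + ρ₃ - (μ₁ - μ₀)))) := by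
        rw [pow_add]
        push_cast
        ring

/-! ## The right factor `W(w, t)` and the factorisation of `G₁` -/

/-- The right factor after grouping `v = w + v' k^{ρ₃}`:
`W(w,t) = k^{−λ'} ∑_{v'<k^{λ'−ρ₃}} e(−(w + v'k^{ρ₃}) t/k^{λ'}) F((w + v'k^{ρ₃}) k^α)`, `α = μ₀ + λ`.
[cite: MauduitRivat2015, Lemma 11 (proof)] -/
def Wfun (U : G →* unitaryGroup d ℂ) (f : ℕ → G) (k μ₀ lam lam' ρ₃ : ℕ) (w : ℕ) (t : ℝ) : Matrix d d ℂ :=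
  (((k ^ lam' : ℕ) : ℂ)⁻¹) • ∑ v' ∈ range (k ^ (lam' - ρ₃)),
    (𝐞 (-(((w + v' * k ^ ρ₃ : ℕ) : ℝ) * t / ((k ^ lam' : ℕ) : ℝ))) : ℂ) •
      umat U f ((w + v' * k ^ ρ₃) * k ^ (μ₀ + lam))

/-- `(a • X) * (b • Y) = (ab) • (XY)` for matrices. [folklore] -/
theorem smul_mul_smul_mat (a b : ℂ) (X Y : Matrix d d ℂ) : (a • X) * (b • Y) = (a * b) • (X * Y) :=
  smul_mul_smul_comm a X b Y

/-- **The factorisation of the main part of `G`** (grouping the digits `v = w + v'k^{ρ₃}` by the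
residue `w` on which the truncated quotient depends): for `ρ₃ ≤ λ'`, `k ≥ 1`,
`dftR k^{λ+λ'} gmatMain t = ∑_{w<k^{ρ₃}} c(w,t) · W(w,t)`.
[cite: MauduitRivat2015, Lemma 11 (proof: "introduce … the residue w of v modulo q^{ρ₃}")] -/
theorem dftR_gmatMain_eq (U : G →* unitaryGroup d ℂ) (f : ℕ → G) {k : ℕ} (hk : 0 < k)
    (μ₀ μ₁ lam : ℕ) {lam' ρ₃ : ℕ} (hρ : ρ₃ ≤ lam') (t : ℝ) :
    dftR (k ^ (lam + lam')) (gmatMain U f k μ₀ μ₁ lam ρ₃) t =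
      ∑ w ∈ range (k ^ ρ₃), cfun U f k μ₀ μ₁ lam lam' w t * Wfun U f k μ₀ lam lam' ρ₃ w t := by
  have hK₁ : 0 < k ^ lam := by positivity
  have hKC : ((k ^ (lam + lam') : ℕ) : ℂ) = ((k ^ lam : ℕ) : ℂ) * ((k ^ lam' : ℕ) : ℂ) := by
    push_cast; rw [pow_add]
  have hK₁C : ((k ^ lam : ℕ) : ℂ) ≠ 0 := by exact_mod_cast hK₁.ne'
  have hK₂C : ((k ^ lam' : ℕ) : ℂ) ≠ 0 := by exact_mod_cast (pow_pos hk lam').ne'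
  have hK₂eq : k ^ lam' = k ^ (ρ₃ + (lam' - ρ₃)) := by congr 1; omega
  -- the common normal form: a triple sum over `(w, a, v')`
  set T : ℕ → ℕ → ℕ → Matrix d d ℂ := fun w a v' =>
    ((((k ^ (lam + lam') : ℕ) : ℂ)⁻¹) * ((𝐞 (-((a : ℝ) * t / ((k ^ (lam + lam') : ℕ) : ℝ))) : ℂ) *
      (𝐞 (-(((w + v' * k ^ ρ₃ : ℕ) : ℝ) * t / ((k ^ lam' : ℕ) : ℝ))) : ℂ))) •
      (Lmat U f k μ₀ μ₁ (μ₀ + lam) a w * umat U f ((w + v' * k ^ ρ₃) * k ^ (μ₀ + lam))) with hT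
  -- (1) the left-hand side
  have hL : dftR (k ^ (lam + lam')) (gmatMain U f k μ₀ μ₁ lam ρ₃) t =
      ∑ w ∈ range (k ^ ρ₃), ∑ a ∈ range (k ^ lam), ∑ v' ∈ range (k ^ (lam' - ρ₃)), T w a v' := by
    rw [dftR_apply, sum_range_pow_add_digitSplit _ k lam lam',
      show range (k ^ lam') = range (k ^ (ρ₃ + (lam' - ρ₃))) by rw [hK₂eq],
      sum_range_pow_add_digitSplit _ k ρ₃ (lam' - ρ₃)]
    simp only [smul_sum]
    -- reorder `(v', w, a) → (w, a, v')`
    rw [sum_comm]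
    refine sum_congr rfl fun w hw => ?_
    rw [sum_comm]
    refine sum_congr rfl fun a ha => sum_congr rfl fun v' _ => ?_
    -- the term
    have ha' := mem_range.1 ha
    have hw' := mem_range.1 hw
    have hmod : (a + (w + v' * k ^ ρ₃) * k ^ lam) % k ^ lam = a := by
      rw [Nat.add_mul_mod_self_right, Nat.mod_eq_of_lt ha']
    have hdiv : (a + (w + v' * k ^ ρ₃) * k ^ lam) / k ^ lam = w + v' * k ^ ρ₃ := by
      rw [Nat.add_mul_div_right _ _ hK₁, Nat.div_eq_of_lt ha', zero_add]
    have hres : (w + v' * k ^ ρ₃) % k ^ ρ₃ = w := by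
      rw [Nat.add_mul_mod_self_right, Nat.mod_eq_of_lt hw']
    rw [hT]; dsimp only
    rw [gmatMain, hmod, hdiv, hres, smul_smul]
    have h1 : ((k ^ lam : ℕ) : ℝ) ≠ 0 := by positivity
    have h2 : ((k ^ lam' : ℕ) : ℝ) ≠ 0 := by positivity
    have hABC : -(((a + (w + v' * k ^ ρ₃) * k ^ lam : ℕ) : ℝ) * t / ((k ^ (lam + lam') : ℕ) : ℝ)) =
        -((a : ℝ) * t / ((k ^ (lam + lam') : ℕ) : ℝ)) +
          -(((w + v' * k ^ ρ₃ : ℕ) : ℝ) * t / ((k ^ lam' : ℕ) : ℝ)) := by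
      push_cast; rw [pow_add]; field_simp; ring
    rw [hABC, ← coe_fourierChar_mul]
  -- (2) the right-hand side
  have hR : ∀ w ∈ range (k ^ ρ₃), cfun U f k μ₀ μ₁ lam lam' w t * Wfun U f k μ₀ lam lam' ρ₃ w t =
      ∑ a ∈ range (k ^ lam), ∑ v' ∈ range (k ^ (lam' - ρ₃)), T w a v' := by
    intro w _
    rw [cfun, Wfun, smul_mul_smul_mat, sum_mul_sum, smul_sum]
    refine sum_congr rfl fun a _ => ?_
    rw [smul_sum]
    refine sum_congr rfl fun v' _ => ?_
    rw [smul_mul_smul_mat, smul_smul, hT]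
    dsimp only
    congr 1
    rw [hKC, mul_inv]
  rw [hL]
  exact sum_congr rfl fun w hw => (hR w hw).symm

/-! ## The mean square of `W(w, ·)` over the integer shifts -/

/-- `dftR` is `K`-periodic in the frequency. [folklore] -/
theorem dftR_add_natCast {E : Type*} [NormedAddCommGroup E] [NormedSpace ℂ E] (K : ℕ) (F : ℕ → E) (t : ℝ) :
    dftR K F (t + K) = dftR K F t := by
  rcases Nat.eq_zero_or_pos K with rfl | hK
  · simp [dftR_apply]
  rw [dftR_apply, dftR_apply]
  congr 1
  refine sum_congr rfl fun u _ => ?_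
  congr 1
  have hKR : (K : ℝ) ≠ 0 := by exact_mod_cast hK.ne'
  have e : -((u : ℝ) * (t + K) / K) = -((u : ℝ) * t / K) + ((-(u : ℤ) : ℤ) : ℝ) := by
    push_cast; field_simp; ring
  rw [e, ← coe_fourierChar_mul, Literature.NumberTheory.Sieve.RamanujanSum.fourierChar_intCast, mul_one]

/-- `W(w,t)` in terms of a discrete Fourier transform of length `k^{λ'−ρ₃}`:
`W(w,t) = (k^{ρ₃})⁻¹ e(−wt/k^{λ'}) · dftR k^{λ'−ρ₃} (v' ↦ F((w+v'k^{ρ₃})k^α)) t` (`ρ₃ ≤ λ'`). [folklore] -/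
theorem Wfun_eq (U : G →* unitaryGroup d ℂ) (f : ℕ → G) {k : ℕ} (hk : 0 < k) (μ₀ lam : ℕ) {lam' ρ₃ : ℕ}
    (hρ : ρ₃ ≤ lam') (w : ℕ) (t : ℝ) :
    Wfun U f k μ₀ lam lam' ρ₃ w t =
      ((((k ^ ρ₃ : ℕ) : ℂ)⁻¹) * (𝐞 (-((w : ℝ) * t / ((k ^ lam' : ℕ) : ℝ))) : ℂ)) •
        dftR (k ^ (lam' - ρ₃)) (fun v' => umat U f ((w + v' * k ^ ρ₃) * k ^ (μ₀ + lam))) t := by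
  have hK₂ : ((k ^ lam' : ℕ) : ℂ) = ((k ^ ρ₃ : ℕ) : ℂ) * ((k ^ (lam' - ρ₃) : ℕ) : ℂ) := by
    push_cast; rw [← pow_add]; congr 1; omega
  have h1 : ((k ^ ρ₃ : ℕ) : ℝ) ≠ 0 := by positivity
  have h2 : ((k ^ (lam' - ρ₃) : ℕ) : ℝ) ≠ 0 := by positivity
  have hK₂R : ((k ^ lam' : ℕ) : ℝ) = ((k ^ ρ₃ : ℕ) : ℝ) * ((k ^ (lam' - ρ₃) : ℕ) : ℝ) := by
    push_cast; rw [← pow_add]; congr 1; omega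
  rw [Wfun, dftR_apply, smul_smul, smul_sum, smul_sum]
  refine sum_congr rfl fun v' _ => ?_
  rw [smul_smul, smul_smul]
  have hABC : -(((w + v' * k ^ ρ₃ : ℕ) : ℝ) * t / ((k ^ lam' : ℕ) : ℝ)) =
      -((w : ℝ) * t / ((k ^ lam' : ℕ) : ℝ)) + -((v' : ℝ) * t / ((k ^ (lam' - ρ₃) : ℕ) : ℝ)) := by
    rw [hK₂R]; push_cast; field_simp; ring
  rw [hABC, ← coe_fourierChar_mul, hK₂, mul_inv]
  congr 1
  ring

/-- **`∑_{j<k^{λ'}} ‖W(w, j+t)‖² = d / k^{ρ₃}`** (periodicity of the transform of length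
`k^{λ'−ρ₃}` over `k^{ρ₃}` periods, then Parseval; `ρ₃ ≤ λ'`, `k ≥ 1`).
[cite: MauduitRivat2015, Lemma 11 (proof, p. 2627 top: the `v`-sum equals `q^{-(μ₂−μ₀−λ)} ∑_v 1`)] -/
theorem sum_norm_sq_Wfun (U : G →* unitaryGroup d ℂ) (f : ℕ → G) {k : ℕ} (hk : 0 < k) (μ₀ lam : ℕ)
    {lam' ρ₃ : ℕ} (hρ : ρ₃ ≤ lam') (w : ℕ) (t : ℝ) :
    ∑ j ∈ range (k ^ lam'), ‖Wfun U f k μ₀ lam lam' ρ₃ w ((j : ℝ) + t)‖ ^ 2 =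
      (Fintype.card d : ℝ) / (k ^ ρ₃ : ℕ) := by
  have hK₃ : 0 < k ^ (lam' - ρ₃) := by positivity
  have hR : (0 : ℝ) < (k ^ ρ₃ : ℕ) := by positivity
  set Fw : ℕ → Matrix d d ℂ := fun v' => umat U f ((w + v' * k ^ ρ₃) * k ^ (μ₀ + lam)) with hFw
  have hnorm : ∀ s : ℝ, ‖Wfun U f k μ₀ lam lam' ρ₃ w s‖ = ((k ^ ρ₃ : ℕ) : ℝ)⁻¹ * ‖dftR (k ^ (lam' - ρ₃)) Fw s‖ := by
    intro s
    rw [Wfun_eq U f hk μ₀ lam hρ, norm_smul, norm_mul, norm_inv, Complex.norm_natCast, norm_fourierChar, mul_one]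
  have hper : ∀ j : ℕ, ‖dftR (k ^ (lam' - ρ₃)) Fw (((j + k ^ (lam' - ρ₃) : ℕ) : ℝ) + t)‖ ^ 2 =
      ‖dftR (k ^ (lam' - ρ₃)) Fw ((j : ℝ) + t)‖ ^ 2 := by
    intro j
    rw [show (((j + k ^ (lam' - ρ₃) : ℕ) : ℝ) + t) = ((j : ℝ) + t) + (k ^ (lam' - ρ₃) : ℕ) by push_cast; ring,
      dftR_add_natCast]
  calc ∑ j ∈ range (k ^ lam'), ‖Wfun U f k μ₀ lam lam' ρ₃ w ((j : ℝ) + t)‖ ^ 2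
      = (((k ^ ρ₃ : ℕ) : ℝ)⁻¹) ^ 2 * ∑ j ∈ range (k ^ (lam' - ρ₃) * k ^ ρ₃),
          ‖dftR (k ^ (lam' - ρ₃)) Fw ((j : ℝ) + t)‖ ^ 2 := by
        rw [show k ^ lam' = k ^ (lam' - ρ₃) * k ^ ρ₃ by rw [← pow_add]; congr 1; omega, mul_sum]
        exact sum_congr rfl fun j _ => by rw [hnorm, mul_pow]
    _ = (((k ^ ρ₃ : ℕ) : ℝ)⁻¹) ^ 2 * ((k ^ ρ₃ : ℕ) * ∑ j ∈ range (k ^ (lam' - ρ₃)),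
          ‖dftR (k ^ (lam' - ρ₃)) Fw ((j : ℝ) + t)‖ ^ 2) := by
        rw [sum_range_mul_of_periodic hper]
    _ = (((k ^ ρ₃ : ℕ) : ℝ)⁻¹) ^ 2 * ((k ^ ρ₃ : ℕ) * Fintype.card d) := by
        rw [sum_norm_sq_dftR hK₃]
        congr 2
        have : ∀ v' ∈ range (k ^ (lam' - ρ₃)), ‖Fw v'‖ ^ 2 = Fintype.card d := by
          intro v' _
          rw [hFw]; dsimp only
          rw [norm_coe_unitary, Real.sq_sqrt (Nat.cast_nonneg _)]
        rw [sum_congr rfl this, sum_const, card_range, nsmul_eq_mul, ← mul_assoc,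
          inv_mul_cancel₀ (by positivity), one_mul]
    _ = (Fintype.card d : ℝ) / (k ^ ρ₃ : ℕ) := by
        field_simp

/-! ## The `G₁`-part -/

/-- **The mean square of the main part** (MR p. 2627): if `‖c(w,s)‖ ≤ Cb` for all `w < k^{ρ₃}`
and all real `s` (so `Cb ≥ 0` when `k ≥ 1`), then `∑_{j<k^{λ'}} ‖dftR k^{λ+λ'} gmatMain (j+t)‖² ≤ d k^{ρ₃} Cb²` (`ρ₃ ≤ λ'`).
[cite: MauduitRivat2015, Lemma 11 (proof, the estimate of `∑_k |G_{…,λ,1}(k+t)|²`)] -/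
theorem sum_norm_sq_dftR_gmatMain_le (U : G →* unitaryGroup d ℂ) (f : ℕ → G) {k : ℕ} (hk : 0 < k)
    (μ₀ μ₁ lam : ℕ) {lam' ρ₃ : ℕ} (hρ : ρ₃ ≤ lam') {Cb : ℝ}
    (hCb : ∀ w, w < k ^ ρ₃ → ∀ s : ℝ, ‖cfun U f k μ₀ μ₁ lam lam' w s‖ ≤ Cb) (t : ℝ) :
    ∑ j ∈ range (k ^ lam'), ‖dftR (k ^ (lam + lam')) (gmatMain U f k μ₀ μ₁ lam ρ₃) ((j : ℝ) + t)‖ ^ 2 ≤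
      Fintype.card d * (k ^ ρ₃ : ℕ) * Cb ^ 2 := by
  have hR : (0 : ℝ) < (k ^ ρ₃ : ℕ) := by positivity
  -- pointwise: `‖G₁(s)‖ ≤ Cb ∑_w ‖W(w,s)‖`, squared with Cauchy–Schwarz
  have hpt : ∀ s : ℝ, ‖dftR (k ^ (lam + lam')) (gmatMain U f k μ₀ μ₁ lam ρ₃) s‖ ^ 2 ≤
      Cb ^ 2 * ((k ^ ρ₃ : ℕ) * ∑ w ∈ range (k ^ ρ₃), ‖Wfun U f k μ₀ lam lam' ρ₃ w s‖ ^ 2) := by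
    intro s
    have h1 : ‖dftR (k ^ (lam + lam')) (gmatMain U f k μ₀ μ₁ lam ρ₃) s‖ ≤
        Cb * ∑ w ∈ range (k ^ ρ₃), ‖Wfun U f k μ₀ lam lam' ρ₃ w s‖ := by
      rw [dftR_gmatMain_eq U f hk μ₀ μ₁ lam hρ, mul_sum]
      refine (norm_sum_le _ _).trans (sum_le_sum fun w hw => ?_)
      refine (Matrix.frobenius_norm_mul _ _).trans ?_
      exact mul_le_mul_of_nonneg_right (hCb w (mem_range.1 hw) s) (norm_nonneg _)
    have h2 := sq_sum_le_card_mul_sum_sq (s := range (k ^ ρ₃)) (f := fun w => ‖Wfun U f k μ₀ lam lam' ρ₃ w s‖)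
    rw [card_range] at h2
    calc ‖dftR (k ^ (lam + lam')) (gmatMain U f k μ₀ μ₁ lam ρ₃) s‖ ^ 2
        ≤ (Cb * ∑ w ∈ range (k ^ ρ₃), ‖Wfun U f k μ₀ lam lam' ρ₃ w s‖) ^ 2 :=
          pow_le_pow_left₀ (norm_nonneg _) h1 2
      _ = Cb ^ 2 * (∑ w ∈ range (k ^ ρ₃), ‖Wfun U f k μ₀ lam lam' ρ₃ w s‖) ^ 2 := by ring
      _ ≤ Cb ^ 2 * ((k ^ ρ₃ : ℕ) * ∑ w ∈ range (k ^ ρ₃), ‖Wfun U f k μ₀ lam lam' ρ₃ w s‖ ^ 2) := by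
          gcongr
  calc ∑ j ∈ range (k ^ lam'), ‖dftR (k ^ (lam + lam')) (gmatMain U f k μ₀ μ₁ lam ρ₃) ((j : ℝ) + t)‖ ^ 2
      ≤ ∑ j ∈ range (k ^ lam'), Cb ^ 2 * ((k ^ ρ₃ : ℕ) *
          ∑ w ∈ range (k ^ ρ₃), ‖Wfun U f k μ₀ lam lam' ρ₃ w ((j : ℝ) + t)‖ ^ 2) :=
        sum_le_sum fun j _ => hpt _
    _ = Cb ^ 2 * (k ^ ρ₃ : ℕ) * ∑ w ∈ range (k ^ ρ₃), ∑ j ∈ range (k ^ lam'),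
          ‖Wfun U f k μ₀ lam lam' ρ₃ w ((j : ℝ) + t)‖ ^ 2 := by
        rw [← mul_sum, ← mul_sum, sum_comm, ← mul_assoc]
    _ = Cb ^ 2 * (k ^ ρ₃ : ℕ) * ∑ _w ∈ range (k ^ ρ₃), (Fintype.card d : ℝ) / (k ^ ρ₃ : ℕ) := by
        congr 1
        exact sum_congr rfl fun w _ => sum_norm_sq_Wfun U f hk μ₀ lam hρ w t
    _ = Fintype.card d * (k ^ ρ₃ : ℕ) * Cb ^ 2 := by
        rw [sum_const, card_range, nsmul_eq_mul]
        field_simp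

/-! ## Lemma 11 and Lemma 10 -/

/-- **Mauduit–Rivat Lemma 11 / Müllner Lemma 5.6, matrix form with raw parameters.** Let `k ≥ 2`,
`F = U ∘ f` with the carry property `HasCarryProperty k η C f` and the Fourier property
`HasFourierProperty k γ c F`; let `μ₀ ≤ μ₁`, `Δ = μ₁ − μ₀ ≤ λ`, `μ₂ = μ₀ + λ + λ'`, `ρ₃ < λ'`,
`μ₀ ≤ c(λ+ρ₃)`. Then for every real `t`,
`∑_{j<k^{λ'}} ‖dftR k^{λ+λ'} (U ∘ g) (j + t)‖² ≤ 18 d k^{ρ₃} (k^{Δ+ρ₃} k^{−γ(λ+ρ₃)} (1 + log k^{λ+ρ₃−Δ}))² + 8 d C k^{−ηρ₃}`,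
`g = midFun k μ₀ μ₁ μ₂ f`. (The printed form (94), `≪ q^{(μ₁−μ₀−γ(λ))/2} (log q^{μ₂−μ₁})²`, follows
with `ρ₃ ≈ (γ(λ)−Δ)/2` and `γ(λ+ρ₃) ≥ γ(λ)`.) [cite: MauduitRivat2015, Lemma 11]
[cite: Mullner2017, Lemma 5.6] -/
theorem sum_norm_sq_dftR_gmat_le (U : G →* unitaryGroup d ℂ) {f : ℕ → G} {k : ℕ} (hk : 2 ≤ k)
    {η C : ℝ} (hcarry : HasCarryProperty k η C f) {γ : ℝ → ℝ} {c : ℝ}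
    (hF : HasFourierProperty k γ c (umat U f)) {μ₀ μ₁ μ₂ lam lam' ρ₃ : ℕ} (h01 : μ₀ ≤ μ₁)
    (hlam : μ₁ - μ₀ ≤ lam) (hsum : μ₀ + lam + lam' = μ₂) (hρ : ρ₃ < lam')
    (hc : (μ₀ : ℝ) ≤ c * ((lam + ρ₃ : ℕ) : ℝ)) (t : ℝ) :
    ∑ j ∈ range (k ^ lam'), ‖dftR (k ^ (lam + lam')) (gmat U f k μ₀ μ₁ μ₂) ((j : ℝ) + t)‖ ^ 2 ≤
      18 * Fintype.card d * (k ^ ρ₃ : ℕ) *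
          ((k : ℝ) ^ (μ₁ - μ₀ + ρ₃) * (k : ℝ) ^ (-γ ((lam + ρ₃ : ℕ) : ℝ)) *
            (1 + Real.log ((k : ℝ) ^ (lam + ρ₃ - (μ₁ - μ₀))))) ^ 2 +
        8 * Fintype.card d * C * (k : ℝ) ^ (-(η * ρ₃)) := by
  have hk0 : 0 < k := by omega
  set Cb : ℝ := 3 * (k : ℝ) ^ (μ₁ - μ₀ + ρ₃) * (k : ℝ) ^ (-γ ((lam + ρ₃ : ℕ) : ℝ)) *
    (1 + Real.log ((k : ℝ) ^ (lam + ρ₃ - (μ₁ - μ₀)))) with hCbdef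
  have hCb : ∀ w, w < k ^ ρ₃ → ∀ s : ℝ, ‖cfun U f k μ₀ μ₁ lam lam' w s‖ ≤ Cb :=
    fun w hw s => norm_cfun_le U f hk hF h01 hlam hc hw s
  -- main and error parts
  have hmain := sum_norm_sq_dftR_gmatMain_le U f hk0 μ₀ μ₁ lam hρ.le hCb t
  have herr := sum_norm_sq_dftR_gmatErr_le_of_carry U hk0 hcarry h01 hlam hsum hρ t
  -- the error sum over `j < k^{λ'}` is at most the full sum over `j < k^{λ+λ'}`
  have herr' : ∑ j ∈ range (k ^ lam'),
      ‖dftR (k ^ (lam + lam')) (fun u => gmat U f k μ₀ μ₁ μ₂ u - gmatMain U f k μ₀ μ₁ lam ρ₃ u) ((j : ℝ) + t)‖ ^ 2 ≤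
      4 * Fintype.card d * C * (k : ℝ) ^ (-(η * ρ₃)) := by
    exact le_trans (sum_le_sum_of_subset_of_nonneg
      (range_subset_range.2 (Nat.pow_le_pow_right hk0 (Nat.le_add_left _ _))) fun _ _ _ => sq_nonneg _) herr
  -- split `gmat = gmatMain + (gmat − gmatMain)` under the transform
  have hsplit : ∀ s : ℝ, dftR (k ^ (lam + lam')) (gmat U f k μ₀ μ₁ μ₂) s =
      dftR (k ^ (lam + lam')) (gmatMain U f k μ₀ μ₁ lam ρ₃) s +
        dftR (k ^ (lam + lam')) (fun u => gmat U f k μ₀ μ₁ μ₂ u - gmatMain U f k μ₀ μ₁ lam ρ₃ u) s := by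
    intro s
    rw [← dftR_add]
    congr 1
    funext u
    abel
  calc ∑ j ∈ range (k ^ lam'), ‖dftR (k ^ (lam + lam')) (gmat U f k μ₀ μ₁ μ₂) ((j : ℝ) + t)‖ ^ 2
      ≤ ∑ j ∈ range (k ^ lam'),
          (2 * ‖dftR (k ^ (lam + lam')) (gmatMain U f k μ₀ μ₁ lam ρ₃) ((j : ℝ) + t)‖ ^ 2 +
            2 * ‖dftR (k ^ (lam + lam')) (fun u => gmat U f k μ₀ μ₁ μ₂ u - gmatMain U f k μ₀ μ₁ lam ρ₃ u)
              ((j : ℝ) + t)‖ ^ 2) := by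
        refine sum_le_sum fun j _ => ?_
        rw [hsplit]
        have h := norm_add_le (dftR (k ^ (lam + lam')) (gmatMain U f k μ₀ μ₁ lam ρ₃) ((j : ℝ) + t))
          (dftR (k ^ (lam + lam')) (fun u => gmat U f k μ₀ μ₁ μ₂ u - gmatMain U f k μ₀ μ₁ lam ρ₃ u) ((j : ℝ) + t))
        have h0 := norm_nonneg (dftR (k ^ (lam + lam')) (gmatMain U f k μ₀ μ₁ lam ρ₃) ((j : ℝ) + t) +
          dftR (k ^ (lam + lam')) (fun u => gmat U f k μ₀ μ₁ μ₂ u - gmatMain U f k μ₀ μ₁ lam ρ₃ u) ((j : ℝ) + t))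
        have h' := pow_le_pow_left₀ h0 h 2
        nlinarith [h', sq_nonneg (‖dftR (k ^ (lam + lam')) (gmatMain U f k μ₀ μ₁ lam ρ₃) ((j : ℝ) + t)‖ -
          ‖dftR (k ^ (lam + lam')) (fun u => gmat U f k μ₀ μ₁ μ₂ u - gmatMain U f k μ₀ μ₁ lam ρ₃ u) ((j : ℝ) + t)‖)]
    _ = 2 * ∑ j ∈ range (k ^ lam'), ‖dftR (k ^ (lam + lam')) (gmatMain U f k μ₀ μ₁ lam ρ₃) ((j : ℝ) + t)‖ ^ 2 +
          2 * ∑ j ∈ range (k ^ lam'),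
            ‖dftR (k ^ (lam + lam')) (fun u => gmat U f k μ₀ μ₁ μ₂ u - gmatMain U f k μ₀ μ₁ lam ρ₃ u) ((j : ℝ) + t)‖ ^ 2 := by
        rw [sum_add_distrib, mul_sum, mul_sum]
    _ ≤ 2 * (Fintype.card d * (k ^ ρ₃ : ℕ) * Cb ^ 2) + 2 * (4 * Fintype.card d * C * (k : ℝ) ^ (-(η * ρ₃))) := by
        gcongr
    _ = _ := by rw [hCbdef]; ring

/-- The discrete Fourier transform `ĝ(h) = dftR k^Λ (U ∘ g) h` at integer frequencies (MR (71), (93)).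
[cite: MauduitRivat2015, (71) and (93)] -/
def ghat (U : G →* unitaryGroup d ℂ) (f : ℕ → G) (k μ₀ μ₁ μ₂ : ℕ) (h : ℕ) : Matrix d d ℂ :=
  dftR (k ^ (μ₂ - μ₀)) (gmat U f k μ₀ μ₁ μ₂) (h : ℝ)

/-- Parseval for `ĝ`: `∑_{h<k^Λ} ‖ĝ(h)‖² = d` (MR (81), matrix form: `K⁻¹ ∑_u ‖U(g(u))‖² = d`).
[cite: MauduitRivat2015, (81)] -/
theorem sum_norm_sq_ghat (U : G →* unitaryGroup d ℂ) (f : ℕ → G) {k : ℕ} (hk : 0 < k) (μ₀ μ₁ μ₂ : ℕ) :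
    ∑ h ∈ range (k ^ (μ₂ - μ₀)), ‖ghat U f k μ₀ μ₁ μ₂ h‖ ^ 2 = Fintype.card d := by
  have hK : 0 < k ^ (μ₂ - μ₀) := by positivity
  have h := sum_norm_sq_dftR hK (gmat U f k μ₀ μ₁ μ₂) 0
  simp only [add_zero] at h
  have e : ∀ u ∈ range (k ^ (μ₂ - μ₀)), ‖gmat U f k μ₀ μ₁ μ₂ u‖ ^ 2 = Fintype.card d := by
    intro u _; rw [norm_gmat, Real.sq_sqrt (Nat.cast_nonneg _)]
  rw [sum_congr rfl e, sum_const, card_range, nsmul_eq_mul, ← mul_assoc, inv_mul_cancel₀ (by positivity),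
    one_mul] at h
  simpa [ghat] using h

/-- **Mauduit–Rivat Lemma 10 / Müllner Lemma 5.6, matrix form (raw parameters)**: with the
hypotheses of `sum_norm_sq_dftR_gmat_le` (`μ₂ − μ₀ = λ + λ'`),
`∑_{h<k^{μ₂−μ₀}} ∑_{j<k^{λ'}} ‖ĝ(h+j) ĝ(h)ᴴ‖² ≤ d · (18 d k^{ρ₃} Cb'² + 8 d C k^{−ηρ₃})`,
`Cb' = k^{Δ+ρ₃} k^{−γ(λ+ρ₃)} (1 + log k^{λ+ρ₃−Δ})` — since `‖ĝ(h+j)ĝ(h)ᴴ‖ ≤ ‖ĝ(h+j)‖‖ĝ(h)‖`, Lemma 11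
bounds the `j`-sum uniformly in the shift `h` and Parseval gives `∑_h ‖ĝ(h)‖² = d`.
[cite: MauduitRivat2015, Lemma 10 and p. 2628 ("It follows from Lemma 11 and (81) that (78) holds")]
[cite: Mullner2017, Lemma 5.6] -/
theorem sum_sum_norm_sq_ghat_mul_le (U : G →* unitaryGroup d ℂ) {f : ℕ → G} {k : ℕ} (hk : 2 ≤ k)
    {η C : ℝ} (hcarry : HasCarryProperty k η C f) {γ : ℝ → ℝ} {c : ℝ}
    (hF : HasFourierProperty k γ c (umat U f)) {μ₀ μ₁ μ₂ lam lam' ρ₃ : ℕ} (h01 : μ₀ ≤ μ₁)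
    (hlam : μ₁ - μ₀ ≤ lam) (hsum : μ₀ + lam + lam' = μ₂) (hρ : ρ₃ < lam')
    (hc : (μ₀ : ℝ) ≤ c * ((lam + ρ₃ : ℕ) : ℝ)) :
    ∑ h ∈ range (k ^ (μ₂ - μ₀)), ∑ j ∈ range (k ^ lam'),
        ‖ghat U f k μ₀ μ₁ μ₂ (h + j) * (ghat U f k μ₀ μ₁ μ₂ h)ᴴ‖ ^ 2 ≤
      Fintype.card d *
        (18 * Fintype.card d * (k ^ ρ₃ : ℕ) *
            ((k : ℝ) ^ (μ₁ - μ₀ + ρ₃) * (k : ℝ) ^ (-γ ((lam + ρ₃ : ℕ) : ℝ)) *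
              (1 + Real.log ((k : ℝ) ^ (lam + ρ₃ - (μ₁ - μ₀))))) ^ 2 +
          8 * Fintype.card d * C * (k : ℝ) ^ (-(η * ρ₃))) := by
  have hk0 : 0 < k := by omega
  have hΛ : μ₂ - μ₀ = lam + lam' := by omega
  set B : ℝ := 18 * Fintype.card d * (k ^ ρ₃ : ℕ) *
      ((k : ℝ) ^ (μ₁ - μ₀ + ρ₃) * (k : ℝ) ^ (-γ ((lam + ρ₃ : ℕ) : ℝ)) *
        (1 + Real.log ((k : ℝ) ^ (lam + ρ₃ - (μ₁ - μ₀))))) ^ 2 +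
      8 * Fintype.card d * C * (k : ℝ) ^ (-(η * ρ₃)) with hB
  have h11 : ∀ h : ℕ, ∑ j ∈ range (k ^ lam'), ‖ghat U f k μ₀ μ₁ μ₂ (h + j)‖ ^ 2 ≤ B := by
    intro h
    have := sum_norm_sq_dftR_gmat_le U hk hcarry hF h01 hlam hsum hρ hc (h : ℝ)
    rw [← hB] at this
    refine le_of_eq_of_le (sum_congr rfl fun j _ => ?_) this
    rw [ghat, hΛ]
    congr 2
    push_cast; ring
  calc ∑ h ∈ range (k ^ (μ₂ - μ₀)), ∑ j ∈ range (k ^ lam'),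
        ‖ghat U f k μ₀ μ₁ μ₂ (h + j) * (ghat U f k μ₀ μ₁ μ₂ h)ᴴ‖ ^ 2
      ≤ ∑ h ∈ range (k ^ (μ₂ - μ₀)), ∑ j ∈ range (k ^ lam'),
          ‖ghat U f k μ₀ μ₁ μ₂ (h + j)‖ ^ 2 * ‖ghat U f k μ₀ μ₁ μ₂ h‖ ^ 2 := by
        refine sum_le_sum fun h _ => sum_le_sum fun j _ => ?_
        rw [← mul_pow]
        refine pow_le_pow_left₀ (norm_nonneg _) ?_ 2
        exact (Matrix.frobenius_norm_mul _ _).trans (by rw [Matrix.frobenius_norm_conjTranspose])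
    _ = ∑ h ∈ range (k ^ (μ₂ - μ₀)), ‖ghat U f k μ₀ μ₁ μ₂ h‖ ^ 2 *
          ∑ j ∈ range (k ^ lam'), ‖ghat U f k μ₀ μ₁ μ₂ (h + j)‖ ^ 2 := by
        refine sum_congr rfl fun h _ => ?_
        rw [mul_sum]
        exact sum_congr rfl fun j _ => mul_comm _ _
    _ ≤ ∑ h ∈ range (k ^ (μ₂ - μ₀)), ‖ghat U f k μ₀ μ₁ μ₂ h‖ ^ 2 * B :=
        sum_le_sum fun h _ => mul_le_mul_of_nonneg_left (h11 h) (sq_nonneg _)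
    _ = Fintype.card d * B := by rw [← sum_mul, sum_norm_sq_ghat U f hk0]

end Literature.NumberTheory.LFunctions.MauduitRivat
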